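import Summits.HodgeConjecture.HodgeConjecture.Theorems.Ring2AbelianAllFermatQuotientCharactersSixfolds
import HarnessLib

/-!
# Fermat characters of the cyclic μ₆-habitats over bases of genus 1, 2, 3 (WEIL-2 gen 32, FERMAT-G32 THEOREM F_q / TABLE T″, fact-free core)

research route, not a corollary; conditional on HC_CM plus one named minimal statement.

Cell `pub-hodge-ring2-ab-*` (ALL ABELIAN VARIETIES), seat WEIL-2 gen 32, account
`run/shared/lean/pub/pub-hodge-ring2/pub-hodge-ring2-ab-weil-2/FERMAT-G32.md` (§2 THEOREM F_q, §3 TABLE T″).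

Informal setting (not formalised; the geometry has no carriers here).  THEOREM F_q of the account: let `C → X` be a connected
cyclic `μ_m`-cover of a smooth projective curve of genus `q` with `b = 2r ≥ 4` branch points and exponents `α ∈ (ℤ/m ∖ 0)^b`
(`Σ α_j = 0`, `gcd(m, α) = 1`), `h = 2q - 2 + b`, `W₀ = G̃∖C^h` Schoen's quotient and `U ⊂ H^h(W₀, ℚ)` the part where `μ_m` acts through
primitive characters [Schoen 1988, §1].  Then `U` is supported on the single fibre of the Abel–Jacobi map `W₀ → S^hX → Pic^h X` over
`K_X + Σ_j b_j` (elsewhere `μ_m` sits in a connected torus acting on the fibre), that fibre is birational to `(X^{b-2}_m/G_α) × ℙ^q`, and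
`U ⊗ ℂ = ρ_* π^* ⊕_{t ∈ (ℤ/m)ˣ} V(tα)` for the smooth model `ℙ_{X^{b-2}_m}(O(m) ⊕ O^q)`: so Weil's Hodge structure on the `μ_m`-primitive
Prym `P_prim(C/X)` is generated by algebraic cycles as soon as the `b`-entry multiset `α` is a CYCLE CHARACTER OF THE FERMAT VARIETY OF
DIMENSION `b - 2` — which [Schoen 1988, Remark 1.10] had observed combinatorially («`𝔅(C, σ) = 𝔅(X^{2r-2}_m)`»).  The theorems below
certify, for the five exponent multisets of the cyclic atlas over bases of genus `1, 2, 3` (`m = 6`, `b ∈ {4, 6}`) that are NOT already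
certified as 8-entry sphere characters in `Ring2AbelianAllFermatQuotientCharactersSixfolds`, (i) the Hodge condition
(`IsHodgeMultiset` = Shioda's `𝔅` = Schoen's Cor. 1.9; for `{1,3,4,4}` and `{1,1,4,4,4,4}` it is already the tree's
`FermatCharacter.isHodgeMultiset_six₁₄₄₃` / `isHodgeMultiset_six₁` and is not restated) and (ii) membership in EVERY `IsShiodaClosed` family through an explicit
decomposition into pairs, the Lefschetz 4-set `{1,3,4,4}` (Aoki–Shioda curves on the Fermat sextic surface `X²_6`) and the semi 6-sets
`{1,2,3 | 4,4,4}`, `{1,1,4 | 4,4,4}` (`X¹_6 × X¹_6`): only [Shioda 1979, Thm I, Thm II c), §4 Lemma 1] and Lefschetz (1,1) are invoked,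
not the condition `(P_6)`.  Types served (gen 10 cyclic atlas, all previously «OPEN»): (3,3) `q = 1`: `[1,2,3,4,4,4]`, `[1,3,3,3,4,4]`,
`[1,1,3,4,4,5]` (non-split), `[1,1,4,4,4,4]` (split, non-simple); (3,3) `q = 2` and (4,4) `q = 3`: `[1,3,4,4]` (non-split — 7- resp.
10-dimensional families in the 9- resp. 16-dimensional non-split components, Lefschetz (1,1) on `X²_6` the only cycle input); (4,4) `q = 2`:
the same four 6-sets.  The rewriting helpers `star_eq`, `pair_eq` are imported from the (3,3) sphere file.
0 sorry, no `def`, no named fact; `HC_CM` does not occur.  All proofs are `decide` on explicit finite data.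
-/

open Multiset
open Literature.AlgebraicGeometry.HodgeTheory.FermatCharacter

namespace Summit.HodgeConjecture.Ring2AbelianAll.FermatQuotientCharactersHigherGenus

open Summit.HodgeConjecture.Ring2AbelianAll.FermatQuotientCharactersSixfolds (star_eq pair_eq)

/-- `[1^1 3^1 4^2]`, `m = 6`: in every `IsShiodaClosed` family — the `surface` field itself (Lefschetz (1,1) on `X²_6`: the class is
carried by Aoki–Shioda curves, `{1,3,4,4}` is not a sum of pairs).  The Hodge condition itself is the tree's
`FermatCharacter.isHodgeMultiset_six₁₄₄₃` (`{1,4,4,3}`), re-checked inline by `decide`.  Cyclic-atlas types (3,3) `q = 2` and (4,4)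
`q = 3`, non-split.  [locator FERMAT-G32 §2 THEOREM F_q (e), §3 TABLE T″]
research route, not a corollary; conditional on HC_CM plus one named minimal statement. -/
theorem mem_of_isShiodaClosed_1_3_4_4 {C : Multiset (ZMod 6) → Prop} (hC : IsShiodaClosed C) :
    C ({1, 3, 4, 4} : Multiset (ZMod 6)) :=
  hC.surface {1, 3, 4, 4} (by unfold IsHodgeMultiset mNormSum; decide) (by decide)

/-- `[1^1 2^1 3^1 4^3]`, `m = 6`: a Hodge multiset — a Hodge character of `X⁴_6` (`b = 6`).  Cyclic-atlas types (3,3) `q = 1` and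
(4,4) `q = 2`, non-split.  [locator FERMAT-G32 §3 TABLE T″]
research route, not a corollary; conditional on HC_CM plus one named minimal statement. -/
theorem isHodgeMultiset_1_2_3_4_4_4 : IsHodgeMultiset ({1, 2, 3, 4, 4, 4} : Multiset (ZMod 6)) := by
  unfold IsHodgeMultiset mNormSum; decide

/-- `[1^1 2^1 3^1 4^3]`, `m = 6`: in every `IsShiodaClosed` family via `semi([1, 2, 3] | [4, 4, 4])` (two characters of the Fermat curve
`X¹_6`; Shioda 1979 §4 Lemma 1).  [locator FERMAT-G32 §2 THEOREM F_q (e), §3]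
research route, not a corollary; conditional on HC_CM plus one named minimal statement. -/
theorem mem_of_isShiodaClosed_1_2_3_4_4_4 {C : Multiset (ZMod 6) → Prop} (hC : IsShiodaClosed C) :
    C ({1, 2, 3, 4, 4, 4} : Multiset (ZMod 6)) :=
  hC.semi {1, 2, 3, 4, 4, 4} (by unfold IsHodgeMultiset mNormSum; decide)
    ⟨{1, 2, 3}, {4, 4, 4}, rfl, rfl, by decide, by decide, by decide⟩

/-- `[1^2 4^4]`, `m = 6`: in every `IsShiodaClosed` family via `semi([1, 1, 4] | [4, 4, 4])` (Shioda 1979 §4 Lemma 1).  The Hodge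
condition itself is the tree's `FermatCharacter.isHodgeMultiset_six₁`, re-checked inline by `decide`.  Cyclic-atlas types (3,3) `q = 1`
and (4,4) `q = 2`, SPLIT but not Schoen-simple.  [locator FERMAT-G32 §2 THEOREM F_q (e), §3 TABLE T″]
research route, not a corollary; conditional on HC_CM plus one named minimal statement. -/
theorem mem_of_isShiodaClosed_1_1_4_4_4_4 {C : Multiset (ZMod 6) → Prop} (hC : IsShiodaClosed C) :
    C ({1, 1, 4, 4, 4, 4} : Multiset (ZMod 6)) :=
  hC.semi {1, 1, 4, 4, 4, 4} (by unfold IsHodgeMultiset mNormSum; decide)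
    ⟨{1, 1, 4}, {4, 4, 4}, rfl, rfl, by decide, by decide, by decide⟩

/-- `[1^1 3^3 4^2]`, `m = 6`: a Hodge multiset — a Hodge character of `X⁴_6` (`b = 6`).  Cyclic-atlas types (3,3) `q = 1` and (4,4)
`q = 2`, non-split.  [locator FERMAT-G32 §3 TABLE T″]
research route, not a corollary; conditional on HC_CM plus one named minimal statement. -/
theorem isHodgeMultiset_1_3_3_3_4_4 : IsHodgeMultiset ({1, 3, 3, 3, 4, 4} : Multiset (ZMod 6)) := by
  unfold IsHodgeMultiset mNormSum; decide

/-- `[1^1 3^3 4^2]`, `m = 6`: in every `IsShiodaClosed` family via `(pair[3, 3] + surface[1, 3, 4, 4])` (Shioda 1979 Thm II c) +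
Lefschetz (1,1) on `X²_6`).  [locator FERMAT-G32 §2 THEOREM F_q (e), §3]
research route, not a corollary; conditional on HC_CM plus one named minimal statement. -/
theorem mem_of_isShiodaClosed_1_3_3_3_4_4 {C : Multiset (ZMod 6) → Prop} (hC : IsShiodaClosed C) :
    C ({1, 3, 3, 3, 4, 4} : Multiset (ZMod 6)) :=
  star_eq hC (t := {3, 3}) (u := {1, 3, 4, 4}) (by decide) (by decide) (by decide)
    (by unfold IsHodgeMultiset mNormSum; decide) (by unfold IsHodgeMultiset mNormSum; decide)
    (pair_eq hC (a := 3) (p := {3, 3}) (by decide) (by decide))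
    (hC.surface {1, 3, 4, 4} (by unfold IsHodgeMultiset mNormSum; decide) (by decide))

/-- `[1^2 3^1 4^2 5^1]`, `m = 6`: a Hodge multiset — a Hodge character of `X⁴_6` (`b = 6`).  Cyclic-atlas types (3,3) `q = 1` and
(4,4) `q = 2`, non-split.  [locator FERMAT-G32 §3 TABLE T″]
research route, not a corollary; conditional on HC_CM plus one named minimal statement. -/
theorem isHodgeMultiset_1_1_3_4_4_5 : IsHodgeMultiset ({1, 1, 3, 4, 4, 5} : Multiset (ZMod 6)) := by
  unfold IsHodgeMultiset mNormSum; decide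

/-- `[1^2 3^1 4^2 5^1]`, `m = 6`: in every `IsShiodaClosed` family via `(pair[1, 5] + surface[1, 3, 4, 4])` (Shioda 1979 Thm II c) +
Lefschetz (1,1) on `X²_6`; the multiset is also semi-decomposable, `[1, 1, 4] | [3, 4, 5]`).  [locator FERMAT-G32 §2 THEOREM F_q (e), §3]
research route, not a corollary; conditional on HC_CM plus one named minimal statement. -/
theorem mem_of_isShiodaClosed_1_1_3_4_4_5 {C : Multiset (ZMod 6) → Prop} (hC : IsShiodaClosed C) :
    C ({1, 1, 3, 4, 4, 5} : Multiset (ZMod 6)) :=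
  star_eq hC (t := {1, 5}) (u := {1, 3, 4, 4}) (by decide) (by decide) (by decide)
    (by unfold IsHodgeMultiset mNormSum; decide) (by unfold IsHodgeMultiset mNormSum; decide)
    (pair_eq hC (a := 1) (p := {1, 5}) (by decide) (by decide))
    (hC.surface {1, 3, 4, 4} (by unfold IsHodgeMultiset mNormSum; decide) (by decide))

end Summit.HodgeConjecture.Ring2AbelianAll.FermatQuotientCharactersHigherGenus
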